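import Summits.BirchSwinnertonDyer.BirchSwinnertonDyer.Theorems.ManinLocalTwoThreeNotTrivialEisensteinModThreeCyclotomicCore
import HarnessLib

/-!
# E-es-69♮ on the irreducible locus: `hNT₃(t)` at EVERY prime `t ≠ 3` when `W[3]` is irreducible

Summit `BirchSwinnertonDyer`, route `ManinLocalTwoThree` (cell bsd-f2-manin), crux C3 `ManinPrimeToThreeAtNine`
(stmt-BirchSwinnertonDyer-22968).  es's law **E-es-69♮** `KatoCurve.NotTrivialEisensteinModThreeMultiplicative`
(`…ManinAdditive.NotTrivialEisensteinLocalisationThree`: «hNT(3) ⟹ hNT(q) at every `q ∥ N`, `q ≠ 3`», the binder `h69n` of es's EDGE 2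
`threeAdicUnitWitness_noMuThree_of_laws'`) is PROVED here ON THE IRREDUCIBLE LOCUS, in the stronger form: for `W[3]` irreducible,
`NotTrivialEisensteinModThreeAt W t` holds at EVERY prime `t ≠ 3` (all exponents; no condition `t ∥ N`, no hNT(3) hypothesis):

* §1 `exists_prime_modEq_one_not_three_dvd_of_smul_ne_of_fixed` — the Chebotarev engine of
  `…NotTrivialEisensteinModThreeWitness` §2 at a prime-power modulus `t^{M+1}`: an element `τ ∈ Γ_ℚ` fixed-point-free on `W[3]` and FIXING
  `μ_{t^{M+1}}` yields good primes `r ∉ S`, `r ≡ 1 (mod t^{M+1})`, `3 ∤ #W̃(𝔽_r)` (Chebotarev in `ℚ(W[3·t^{M+1}])`; the Weil pairing puts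
  `μ_{t^{M+1}}` inside `ℚ(W[t^{M+1}])`).
* §2 **`notTrivialEisensteinModThreeAt_of_irreducible`** (`t` prime, `t ≠ 3`, any elliptic `W`, via a global minimal model) from the core
  `exists_smul_ne_of_fixed_of_irreducible` (`…CyclotomicCore`), and the restriction
  **`notTrivialEisensteinModThreeMultiplicative_of_irreducible`** of es's law E-es-69♮ to the irreducible locus (literally its binder shape
  plus `W.HasIrreducibleModPGaloisRep 3`).

What remains of E-es-69♮ is the REDUCIBLE locus: there hNT(q) ⟺ the `3`-isogeny characters avoid `{ε_{q*}, ε_{−3q*}}`, i.e. are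
unramified at the multiplicative prime `q` — Tate-curve input (tree `natCard_map_inertia_galoisRepTorsion_dvd_prime_pow`) plus total
ramification of `ℚ(μ_{q^M})` at `q`; not done here.  Axioms standard; no definitions; nothing about BSD, Manin's conjecture, C2/C3 or
E-es-69 is proved.  References: J. Tate, *Global class field theory* (Cassels–Fröhlich 1967) §2.4, §3.4; J.-P. Serre, Invent. Math. 15
(1972) §5.2; J. H. Silverman, *AEC* III.8.1.1, VII.3.1; HOME/MEMO-es.md §32 (E-es-69♮).
-/

set_option autoImplicit false
set_option linter.dupNamespace false

noncomputable section

open scoped Classical Matrix MatrixGroups ModularForm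

open NumberField IsDedekindDomain Field WeierstrassCurve CongruenceSubgroup
  Literature.NumberTheory.EllipticCurves Literature.NumberTheory.EllipticCurves.ModularForms
  Literature.NumberTheory.GaloisRepresentations
  Summit.BirchSwinnertonDyer.Rank1Residual.ManinAdditive
  Summit.BirchSwinnertonDyer.Rank1Residual.ManinAdditive.KatoCurve

namespace Summit.BirchSwinnertonDyer.BirchSwinnertonDyer.Theorems.ManinLocalTwoThree

/-! ### §1  The Chebotarev engine at a prime-power modulus `t^{M+1}` -/

section Engine

/-- **Good primes `r ≡ 1 (mod t^{M+1})` off `S` with `3 ∤ #W̃(𝔽_r)`, from an element fixed-point-free on `W[3]` that fixes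
`μ_{t^{M+1}}`** (`W` globally minimal, `t` prime).  Chebotarev (`chebotarev_geomTorsion_holds`) in `ℚ(W[3·t^{M+1}])` gives a good prime
`r ∉ S ∪ {3, t}` whose Frobenius `φ` acts on `W[3·t^{M+1}]` as `τ`: on `W[3]` it is fixed-point-free, so `3 ∤ #W̃(𝔽_r)`
(`exists_frobenius_smul_eq_of_dvd_reductionPointCount_holds`); `τ⁻¹φ` fixes `W[t^{M+1}]` pointwise hence the primitive root
`ζ ∈ ℚ(W[t^{M+1}])` of the Weil pairing (`exists_isPrimitiveRoot_fixed`), so `φζ = τζ = ζ`, while `φζ = ζ^r`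
(`frob_smul_eq_pow_of_pow_eq_one_prime`): `r ≡ 1 (mod t^{M+1})`.
[cite: TateGCFT1967, §2.4 (Tchebotarev density theorem)] [cite: SilvermanAEC2009, Cor. III.8.1.1 and Prop. VII.3.1] -/
theorem exists_prime_modEq_one_not_three_dvd_of_smul_ne_of_fixed (W : WeierstrassCurve ℚ) [W.IsElliptic]
    [W.IsGloballyMinimal] {t : ℕ} (ht : t.Prime) (M : ℕ) (τ : absoluteGaloisGroup ℚ)
    (hτ : ∀ P : W.geomTorsion ((3 : ℕ) : ℤ), P ≠ 0 → τ • P ≠ P)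
    (hfix : ∀ ζ : AlgebraicClosure ℚ, ζ ^ t ^ (M + 1) = 1 → τ • ζ = ζ) (S : Finset ℕ) :
    ∃ (r : ℕ) (_ : Fact r.Prime), r ∉ S ∧ r ≠ 3 ∧ r ≡ 1 [MOD t ^ (M + 1)] ∧ W.HasGoodReductionAtPrime r ∧
      ¬ 3 ∣ W.reductionPointCount r := by
  classical
  set q : ℕ := t ^ (M + 1) with hqdef
  have hq2 : 2 ≤ q := by
    calc (2 : ℕ) ≤ t ^ 1 := by rw [pow_one]; exact ht.two_le
      _ ≤ t ^ (M + 1) := Nat.pow_le_pow_right ht.pos (by omega)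
  have hqpos : 0 < q := by omega
  set n : ℕ := 3 * q with hndef
  have hn0 : ((n : ℕ) : ℤ) ≠ 0 := by rw [hndef]; positivity
  -- a primitive `q`-th root of unity fixed by the pointwise stabiliser of `W[q]`
  obtain ⟨ζ, hζ, hζfix⟩ := exists_isPrimitiveRoot_fixed (E := W) (q := q) hq2
    (exists_geomTorsion_exactOrder_prime W ht M)
  have hne : ζ ≠ 0 := hζ.ne_zero hqpos.ne'
  -- Chebotarev off `S ∪ {3, t} ∪ {bad primes}`
  have hΔ0 : minimalDiscriminantInt W ≠ 0 := minimalDiscriminantInt_ne_zero W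
  let S' : Set ℕ := {ℓ | ℓ = 3 ∨ ℓ = t ∨ (ℓ : ℤ) ∣ minimalDiscriminantInt W ∨ ℓ ∈ S}
  have hS' : S'.Finite := by
    refine ((Set.finite_le_nat (max (max 3 t) (minimalDiscriminantInt W).natAbs)).union
      (S : Set ℕ).toFinite).subset ?_
    rintro ℓ (rfl | rfl | hℓ | hℓ)
    · exact Or.inl (Set.mem_setOf.mpr (le_max_of_le_left (le_max_left _ _)))
    · exact Or.inl (Set.mem_setOf.mpr (le_max_of_le_left (le_max_right _ _)))
    · exact Or.inl (Set.mem_setOf.mpr (le_max_of_le_right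
        (Nat.le_of_dvd (Int.natAbs_pos.mpr hΔ0) (Int.natCast_dvd.mp hℓ))))
    · exact Or.inr hℓ
  obtain ⟨ℓ, v, 𝔓, φ, hℓ, hℓS, hv, h𝔓, hφ, hagree⟩ :=
    chebotarev_geomTorsion_holds W ((n : ℕ) : ℤ) hn0 S' hS' τ
  haveI : Fact ℓ.Prime := ⟨hℓ⟩
  have hℓ3 : ℓ ≠ 3 := fun h ↦ hℓS (Or.inl h)
  have hℓt : ℓ ≠ t := fun h ↦ hℓS (Or.inr (Or.inl h))
  have hℓΔ : ¬ (ℓ : ℤ) ∣ minimalDiscriminantInt W := fun h ↦ hℓS (Or.inr (Or.inr (Or.inl h)))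
  have hℓS₀ : ℓ ∉ S := fun h ↦ hℓS (Or.inr (Or.inr (Or.inr h)))
  have hgood : W.HasGoodReductionAtPrime ℓ := hasGoodReductionAtPrime_of_not_dvd W ℓ hℓΔ
  -- `W[q] ⊆ W[3q]` and `W[3] ⊆ W[3q]`
  have hmem_q : ∀ T : W.geomTorsion ((q : ℕ) : ℤ), (T : W.geomPoints) ∈ W.geomTorsion ((n : ℕ) : ℤ) := by
    intro T
    have hT : ((q : ℕ) : ℤ) • (T : W.geomPoints) = 0 := by
      simpa only [AddSubgroup.torsionBy, Submodule.mem_toAddSubgroup, Submodule.mem_torsionBy_iff] using T.2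
    simp only [Submodule.mem_toAddSubgroup, Submodule.mem_torsionBy_iff]
    rw [hndef, Nat.cast_mul, mul_smul]
    show ((3 : ℕ) : ℤ) • (((q : ℕ) : ℤ) • (T : W.geomPoints)) = 0
    rw [hT, smul_zero]
  have hmem_3 : ∀ P : W.geomTorsion ((3 : ℕ) : ℤ), (P : W.geomPoints) ∈ W.geomTorsion ((n : ℕ) : ℤ) := by
    intro P
    have hP : ((3 : ℕ) : ℤ) • (P : W.geomPoints) = 0 := by
      simpa only [AddSubgroup.torsionBy, Submodule.mem_toAddSubgroup, Submodule.mem_torsionBy_iff] using P.2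
    simp only [Submodule.mem_toAddSubgroup, Submodule.mem_torsionBy_iff]
    rw [hndef, Nat.cast_mul, mul_comm, mul_smul]
    show ((q : ℕ) : ℤ) • (((3 : ℕ) : ℤ) • (P : W.geomPoints)) = 0
    rw [hP, smul_zero]
  -- the Frobenius fixes `ζ`
  have hψ : ∀ T : W.geomTorsion ((q : ℕ) : ℤ), (τ⁻¹ * φ) • T = T := by
    intro T
    have hval : φ • (T : W.geomPoints) = τ • (T : W.geomPoints) :=
      congrArg Subtype.val (hagree ⟨T, hmem_q T⟩)
    apply Subtype.ext
    rw [AddSubgroup.torsionBy.coe_smul, mul_smul, hval, inv_smul_smul]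
  have hφζ : φ • ζ = ζ := by
    have h1 := hζfix _ hψ
    rw [mul_smul] at h1
    have h2 := congrArg (fun x ↦ τ • x) h1
    simp only [smul_inv_smul] at h2
    rw [h2, hfix ζ hζ.pow_eq_one]
  -- `ℓ ≡ 1 (mod q)`
  have hfrob := frob_smul_eq_pow_of_pow_eq_one_prime (k := M + 1) hℓ ht hℓt hv h𝔓 hφ hζ.pow_eq_one
  have hℓ1 : ℓ ≡ 1 [MOD q] := by
    have hz : ζ ^ ℓ = ζ := by rw [← hfrob, hφζ]
    have h1 : ζ ^ (ℓ - 1) = 1 := by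
      have : ζ ^ (ℓ - 1) * ζ = 1 * ζ := by
        rw [← pow_succ, Nat.sub_add_cancel hℓ.one_le, one_mul, hz]
      exact mul_right_cancel₀ hne this
    have hdvd := (hζ.pow_eq_one_iff_dvd (ℓ - 1)).mp h1
    exact ((Nat.modEq_iff_dvd' hℓ.one_le).mpr hdvd).symm
  -- `3 ∤ #W̃(𝔽_ℓ)`
  refine ⟨ℓ, ⟨hℓ⟩, hℓS₀, hℓ3, hℓ1, hgood, fun hdvd3 ↦ ?_⟩
  obtain ⟨P, hP0, hP⟩ :=
    exists_frobenius_smul_eq_of_dvd_reductionPointCount_holds W 3 ℓ hℓ3 hgood hdvd3 v hv 𝔓 h𝔓 φ hφ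
  have hval : φ • (P : W.geomPoints) = τ • (P : W.geomPoints) :=
    congrArg Subtype.val (hagree ⟨P, hmem_3 P⟩)
  apply hτ P hP0
  apply Subtype.ext
  rw [AddSubgroup.torsionBy.coe_smul, ← hval, ← AddSubgroup.torsionBy.coe_smul, hP]

end Engine

/-! ### §2  E-es-69♮ on the irreducible locus -/

/-- **Good primes `r ≡ 1 (mod t^{M+1})` off `S` with `3 ∤ #W̃(𝔽_r)` when `W[3]` is irreducible** (`W` globally minimal, `t ≠ 3`
prime): `exists_smul_ne_of_fixed_of_irreducible` (with `m = t^{M+1}`, prime to `3`) feeds the engine of §1.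
[cite: TateGCFT1967, §2.4 (Tchebotarev density theorem)] [cite: Serre1972, §5.2 (iii)–(iv)] -/
theorem exists_prime_modEq_one_not_three_dvd_of_irreducible (W : WeierstrassCurve ℚ) [W.IsElliptic]
    [W.IsGloballyMinimal] (hirr : W.HasIrreducibleModPGaloisRep 3) {t : ℕ} (ht : t.Prime) (ht3 : t ≠ 3)
    (S : Finset ℕ) (M : ℕ) :
    ∃ (r : ℕ) (_ : Fact r.Prime), r ∉ S ∧ r ≠ 3 ∧ r ≡ 1 [MOD t ^ (M + 1)] ∧ W.HasGoodReductionAtPrime r ∧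
      ¬ 3 ∣ W.reductionPointCount r := by
  haveI : NeZero (t ^ (M + 1)) := ⟨pow_ne_zero _ ht.ne_zero⟩
  have hm : Nat.Coprime 3 (t ^ (M + 1)) :=
    ((Nat.coprime_primes Nat.prime_three ht).mpr (Ne.symm ht3)).pow_right _
  obtain ⟨τ, hfix, hτ⟩ := exists_smul_ne_of_fixed_of_irreducible W hirr hm
  exact exists_prime_modEq_one_not_three_dvd_of_smul_ne_of_fixed W ht M τ hτ hfix S

/-- **E-es-69♮ holds on the irreducible locus, at every prime `t ≠ 3`**: for an elliptic `W/ℚ` with `W[3]` irreducible and a prime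
`t ≠ 3`, `NotTrivialEisensteinModThreeAt W t` — every finite `S` and every `M` admit a prime `r ∉ S`, `r ≡ 1 (mod t^M)`, with
`a_r(W) ≢ r + 1 (mod 3)`.  Reduction to a global minimal model (`hasGlobalMinimalModel_rat_holds`, `LFunction_smul`,
`hasIrreducibleModPGaloisRep_smul_iff`, `LFunction_apply_prime_eq_frobeniusTrace`, `dvd_frobeniusTrace_sub_iff`) as in E-es-40₃.
[cite: TateGCFT1967, §2.4 (Tchebotarev density theorem)] [cite: Serre1972, §5.2 (iii)–(iv)] -/
theorem notTrivialEisensteinModThreeAt_of_irreducible (W : WeierstrassCurve ℚ) [W.IsElliptic]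
    (hirr : W.HasIrreducibleModPGaloisRep 3) {t : ℕ} (ht : t.Prime) (ht3 : t ≠ 3) :
    NotTrivialEisensteinModThreeAt W t := by
  intro S M
  classical
  obtain ⟨C, hC⟩ := WeierstrassCurve.hasGlobalMinimalModel_rat_holds W
  haveI := hC
  have hirr' : (C • W).HasIrreducibleModPGaloisRep 3 :=
    (Mazur1978.hasIrreducibleModPGaloisRep_smul_iff W C 3).mpr hirr
  obtain ⟨r, hr, hrS, _, hmod, hgood, hndvd⟩ :=
    exists_prime_modEq_one_not_three_dvd_of_irreducible (C • W) hirr' ht ht3 S M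
  refine ⟨r, hr.out, hrS, ?_, ?_⟩
  · rw [pow_succ'] at hmod
    exact Nat.ModEq.of_mul_left t hmod
  · rw [← WeierstrassCurve.LFunction_smul W C, WeierstrassCurve.LFunction_apply_prime_eq_frobeniusTrace (C • W) r hgood]
    intro heq
    apply hndvd
    have h3 : ((((r : ℤ) + 1 : ℤ)) : ZMod 3) = (((C • W).frobeniusTrace r : ℤ) : ZMod 3) := by
      rw [heq]; push_cast; ring
    have h3' := (ZMod.intCast_eq_intCast_iff_dvd_sub ((r : ℤ) + 1) ((C • W).frobeniusTrace r) 3).mp h3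
    exact (dvd_frobeniusTrace_sub_iff (C • W) 3 r).mp (by exact_mod_cast h3')

/-- **es's law E-es-69♮ `NotTrivialEisensteinModThreeMultiplicative` restricted to the irreducible locus** (its binder shape verbatim,
plus `W.HasIrreducibleModPGaloisRep 3`; the hypotheses `IsNewformOf W f`, hNT(3) and `q ∥ N` are not even needed there).
[cite: TateGCFT1967, §2.4 (Tchebotarev density theorem)] -/
theorem notTrivialEisensteinModThreeMultiplicative_of_irreducible :
    ∀ (W : WeierstrassCurve ℚ) [W.IsElliptic] {N : ℕ} [NeZero N] (f : CuspForm (Gamma0 N) 2),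
      IsNewformOf W f → W.HasIrreducibleModPGaloisRep 3 → NotTrivialEisensteinModThreeAt W 3 →
      ∀ q ∈ N.primeFactors, q ≠ 3 → ¬ q ^ 2 ∣ N → NotTrivialEisensteinModThreeAt W q := by
  intro W _ N _ f _ hirr _ q hq hq3 _
  exact notTrivialEisensteinModThreeAt_of_irreducible W hirr (Nat.prime_of_mem_primeFactors hq) hq3

end Summit.BirchSwinnertonDyer.BirchSwinnertonDyer.Theorems.ManinLocalTwoThree

end
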